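import Summits.CriticalPhenomena.SAWScalingLimit.Theorems.SAWDefectDecoherenceBoundaryClosureRDressedArrival
import Summits.CriticalPhenomena.SAWScalingLimit.Theorems.MassRatio.Negative.Component
import Summits.CriticalPhenomena.SAWScalingLimit.Theorems.MassRatio.Negative.Walks
import Literature.Probability.RandomPlanarGeometry.HexParafermionSpinShift

/-!
# Total boundary arrival mass from a boundary root is at least `1`; slit domains are simply
connected; the tip sum rule (crux `MassRatio`, stmt-CriticalPhenomena-8550; STRATEGY-CENSUS §6 (E2))

Three frame-independent facts about the critical spin-`0` two-point masses
`Z_Λ(a → z) = ‖F^{Λ}_{x_c,0}(z)‖` of a simply connected hexagonal domain `Λ` with boundary root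
`a = {u ∉ Λ, w ∈ Λ}`:

* `one_le_sum_boundary_arrival` — the total arrival mass at the NON-ROOT boundary darts is at least
  `1`: `1 ≤ Σ_{v ∈ Λ} Σ_{t ∼ v, t ∉ Λ, (v,t) ≠ (w,u)} Z_Λ(a → {t,v})`. Proof: the boundary flux
  identity `Σ_{darts ≠ root} (mid − c_v)·F_{x_c,5/8}({v,t}) = (c_w − c_u)/2` (DCS Lemma 1 summed over
  `Λ`, `PickHalfPlane.Dressed.boundaryTerm_sum_eq`), the triangle inequality, `‖mid − c_v‖ =
  ‖(c_w − c_u)/2‖` (all honeycomb edges have length `1/√3`) and `‖F_{x_c,5/8}‖ ≤ Z` — no winding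
  analysis (the sharper "tame" form with weights `cos(3W/8)` is `dressed_sum_re_im`).
* `simplyConnected_slit` — deleting the vertices of a self-avoiding walk `γ` from the boundary root
  keeps the domain simply connected (`Λᶜ ∪ γ` is linked through `u`).
* `tip_continuation_ge_one` — hence, for a walk `γ ⊂ Ω : a → e` whose tip mid-edge `e = {v, t}`
  (`v = last γ`) has its far endpoint FREE (`t ∈ Λ`, `t ∉ γ`), the continuation masses from the tip in
  the slit domain `Λ ∖ γ`, summed over the boundary darts of the slit domain other than the tip's
  own (arrivals at `∂Ω` AND at the faces of `γ` itself), total at least `1` — engine step (E2) of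
  the census's `PolyBulk` sketch ("the continuation mass from ANY tip is at least 1"), in the
  weight-free form; a trapped tip (`t ∉ Λ ∖ γ`) has no continuation and is excluded.

Deliberately NOT here: the tame/wild splitting by windings; `CageTail`; anything asymptotic.
-/

noncomputable section

namespace Summit.CriticalPhenomena.SAWScalingLimit.Theorems.MassRatio.Occupation

open Literature.Probability.LatticeModels Literature.Probability.RandomPlanarGeometry
open Literature.Probability.RandomPlanarGeometry.SAW
open Literature.Barriers.CriticalPhenomena Literature.Barriers.CriticalPhenomena.HexGreen
open Summit.CriticalPhenomena.SAWScalingLimit.Theorems.MassRatio.Negative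
open Summit.CriticalPhenomena.SAWScalingLimit.Theorems.PickHalfPlane

variable {Λ : Finset HexVertex} {u w : HexVertex} {e : Sym2 HexVertex}

/-! ### Total boundary arrival mass `≥ 1` -/

/-- The norm of a boundary half-edge term: `‖(mid − c_v)·F({v,t})‖ = (1/(2√3))·‖F({v,t})‖` for
adjacent `v, t`. [folklore] -/
theorem norm_term_of_adj (F : Sym2 HexVertex → ℂ) {v t : HexVertex} (h : hexGraph.Adj v t) :
    ‖HexKernel.term F v t‖ = (Real.sqrt 3)⁻¹ / 2 * ‖F s(v, t)‖ := by
  have hm : hexMidpoint s(v, t) - hexCenter v = (hexCenter t - hexCenter v) / 2 := by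
    rw [hexMidpoint_mk]; ring
  rw [HexKernel.term, norm_mul, hm, norm_div, Complex.norm_two, norm_hexCenter_sub_of_adj h]

/-- **Total boundary arrival mass from a boundary root is at least `1`.** For a simply connected
`Λ` with boundary root `a = {u, w}` (`u ∉ Λ ∋ w` adjacent), the critical spin-`0` masses
`Z_Λ(a → {t, v})` summed over the boundary darts `(v, t)` (`v ∈ Λ ∌ t` adjacent) other than the
root dart `(w, u)` total at least `1`. (Flux identity `Σ_{darts ≠ root}(mid − c_v)F_{x_c,5/8} =
(c_w − c_u)/2`, triangle inequality, equal half-edge lengths, `‖F_{x_c,5/8}‖ ≤ Z`.)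
[cite: DuminilCopinSmirnov2012, §3 (proof of Lemma 2: sum of the vertex relation, `F(a) = 1`)] -/
theorem one_le_sum_boundary_arrival (hΛ : hexDomainSimplyConnected Λ) (huw : hexGraph.Adj u w)
    (hu : u ∉ Λ) (hw : w ∈ Λ) :
    1 ≤ ∑ v ∈ Λ, ∑ t ∈ (nbrs v).filter (· ∉ Λ),
      (if v = w ∧ t = u then 0 else
        ‖hexParafermionicObservable Λ s(u, w) hexCriticalFugacity 0 s(t, v)‖) := by
  classical
  set F := hexParafermionicObservable Λ s(u, w) hexCriticalFugacity (5 / 8) with hF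
  have key := Dressed.boundaryTerm_sum_eq hΛ huw hu hw
  have hL : (0 : ℝ) < (Real.sqrt 3)⁻¹ / 2 := by positivity
  have hA : ‖(hexCenter w - hexCenter u) / 2‖ = (Real.sqrt 3)⁻¹ / 2 := by
    rw [norm_div, Complex.norm_two, norm_hexCenter_sub_of_adj huw]
  -- triangle inequality on the flux identity
  have h1 : (Real.sqrt 3)⁻¹ / 2 ≤ ∑ v ∈ Λ, ∑ t ∈ (nbrs v).filter (· ∉ Λ),
      ‖(if v = w ∧ t = u then 0 else HexKernel.term F v t)‖ := by
    rw [← hA, ← key]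
    refine (norm_sum_le _ _).trans (Finset.sum_le_sum fun v _ => norm_sum_le _ _)
  -- each term: `‖(mid − c_v) F_{5/8}({v,t})‖ ≤ (1/(2√3)) Z({t,v})`
  have h2 : ∀ v ∈ Λ, ∀ t ∈ (nbrs v).filter (· ∉ Λ),
      ‖(if v = w ∧ t = u then 0 else HexKernel.term F v t)‖ ≤
        (Real.sqrt 3)⁻¹ / 2 * (if v = w ∧ t = u then 0 else
          ‖hexParafermionicObservable Λ s(u, w) hexCriticalFugacity 0 s(t, v)‖) := by
    intro v _ t ht
    have hvt : hexGraph.Adj v t := (mem_nbrs_iff v t).1 (Finset.mem_filter.1 ht).1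
    split_ifs
    · simp
    · have hsw : (s(v, t) : Sym2 HexVertex) = s(t, v) := Sym2.eq_swap
      rw [norm_term_of_adj F hvt, hF, hsw]
      refine mul_le_mul_of_nonneg_left ?_ hL.le
      rw [norm_Z_eq_sum _ _ _ hexCriticalFugacity_pos_lt_one.1.le]
      exact norm_hexParafermionicObservable_le _ _ hexCriticalFugacity_pos_lt_one.1.le _ _
  have h3 := h1.trans (Finset.sum_le_sum fun v hv => Finset.sum_le_sum fun t ht => h2 v hv t ht)
  simp_rw [← Finset.mul_sum] at h3
  exact le_of_mul_le_mul_left (by linarith) hL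

/-! ### Slit domains are simply connected -/

/-- **Deleting a self-avoiding walk from the boundary root keeps the domain simply connected**:
for `Λ` simply connected with root `a = {u, w}` (`u ∉ Λ`) and `γ ⊂ Ω : a → e`, the complement of
`Λ ∖ γ` — which is `Λᶜ ∪ γ` — is linked: `Λᶜ` is linked by hypothesis, and the chain `γ` hangs on
`u ∈ Λᶜ` through its first vertex `w`. [folklore] -/
theorem simplyConnected_slit (hΛ : hexDomainSimplyConnected Λ) (hu : u ∉ Λ)
    (γ : HexMidEdgeSAW Λ s(u, w) e) : hexDomainSimplyConnected (Λ \ γ.verts.toFinset) := by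
  classical
  set S : Set HexVertex := ((↑(Λ \ γ.verts.toFinset) : Set HexVertex))ᶜ with hS
  have hmemS : ∀ x, x ∈ S ↔ x ∉ Λ ∨ x ∈ γ.verts := by
    intro x
    rw [hS, Set.mem_compl_iff, Finset.mem_coe, Finset.mem_sdiff, List.mem_toFinset]
    tauto
  have hcS : (↑Λ : Set HexVertex)ᶜ ⊆ S := fun x hx => (hmemS x).2 (Or.inl hx)
  have huS : u ∈ S := (hmemS u).2 (Or.inl hu)
  -- every point of `Λᶜ` is linked to `u` inside `Λᶜ ⊆ S`
  have hout : ∀ x, x ∉ Λ → Linked S u x := by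
    intro x hx
    refine Linked.mono hcS ⟨hu, hx, ?_⟩
    exact hΛ ⟨u, hu⟩ ⟨x, hx⟩
  -- every vertex of `γ` is linked to `u` inside `{u} ∪ γ ⊆ S`
  have hin : ∀ x ∈ γ.verts, Linked S u x := by
    intro x hx
    have hne : γ.verts ≠ [] := List.ne_nil_of_mem hx
    obtain ⟨y, l, hyl⟩ := List.exists_cons_of_ne_nil hne
    have hy : y = w := by
      have hmem : y ∈ s(u, w) := γ.head_mem y (by rw [hyl]; rfl)
      rcases Sym2.mem_iff.1 hmem with rfl | rfl
      · exact absurd (γ.subset y (by rw [hyl]; simp)) hu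
      · rfl
    subst hy
    have huw : hexGraph.Adj u y := (SimpleGraph.mem_edgeSet _).1 γ.fst_mem.1
    have hch : (u :: y :: l).IsChain hexGraph.Adj :=
      List.IsChain.cons_cons huw (hyl ▸ γ.isChain)
    have hsub : ∀ v ∈ u :: y :: l, v ∈ insert u γ.verts.toFinset := by
      intro v hv
      rcases List.mem_cons.1 hv with rfl | hv
      · exact Finset.mem_insert_self _ _
      · exact Finset.mem_insert_of_mem (List.mem_toFinset.2 (hyl ▸ hv))
    have hl := chain_linked (Λ := insert u γ.verts.toFinset) (y :: l) u hch hsub x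
      (List.mem_cons_of_mem _ (hyl ▸ hx))
    refine hl.mono fun v hv => ?_
    rcases Finset.mem_insert.1 (Finset.mem_coe.1 hv) with rfl | hv
    · exact huS
    · exact (hmemS v).2 (Or.inr (List.mem_toFinset.1 hv))
  have hall : ∀ x ∈ S, Linked S u x := fun x hx => by
    rcases (hmemS x).1 hx with hx | hx
    · exact hout x hx
    · exact hin x hx
  exact preconnected_of_linked fun x hx y hy => (hall x hx).symm.trans (hall y hy)

/-! ### The tip sum rule -/

/-- **The tip sum rule (census (E2), weight-free form).** Let `Λ` be simply connected with boundary
root `a = {u, w}` (`u ∉ Λ ∋ w`), `γ ⊂ Ω : a → {v, t}` a nonempty self-avoiding walk with tip vertex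
`v = last γ`, and suppose the tip mid-edge `{v, t}` is a mid-edge of the slit domain `Λ' = Λ ∖ γ`
(equivalently: the far endpoint is FREE, `t ∈ Λ`, `t ∉ γ`, and `v ∼ t`).
Then in `Λ'` (rooted at the tip dart `(t, v)`), the continuation masses
`Z_{Λ'}(e → {t', v'})` summed over the boundary darts `(v', t')` of `Λ'` other than `(t, v)` —
arrivals at `∂Ω` and at the faces of `γ` itself — total at least `1`.
[cite: DuminilCopinSmirnov2012, §3 (sum of the vertex relation over a domain)] -/
theorem tip_continuation_ge_one : ∀ (Λ : Finset HexVertex), hexDomainSimplyConnected Λ → ∀ (u w : HexVertex), u ∉ Λ → ∀ (v t : HexVertex) (γ : HexMidEdgeSAW Λ s(u, w) s(v, t)) (hne : γ.verts ≠ []), γ.verts.getLast hne = v → s(v, t) ∈ hexDomainMidEdges (Λ \ γ.verts.toFinset) → 1 ≤ ∑ v' ∈ Λ \ γ.verts.toFinset, ∑ t' ∈ (nbrs v').filter (· ∉ Λ \ γ.verts.toFinset), (if v' = t ∧ t' = v then 0 else ‖hexParafermionicObservable (Λ \ γ.verts.toFinset) s(v, t) hexCriticalFugacity 0 s(t', v')‖)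 := by
  intro Λ hΛ u w hu v t γ hne hv heM
  have hΛ' := simplyConnected_slit hΛ hu γ
  have hvγ : v ∈ γ.verts := by
    have h := List.getLast_mem hne
    rwa [hv] at h
  have hv' : v ∉ Λ \ γ.verts.toFinset := fun h =>
    (Finset.mem_sdiff.1 h).2 (List.mem_toFinset.2 hvγ)
  obtain ⟨hE, x, hx, hxΛ'⟩ := heM
  -- the endpoint of the tip mid-edge in the slit domain is the far one, `t`
  have ht' : t ∈ Λ \ γ.verts.toFinset := by
    rcases Sym2.mem_iff.1 hx with rfl | rfl
    · exact absurd hxΛ' hv'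
    · exact hxΛ'
  exact one_le_sum_boundary_arrival hΛ' ((SimpleGraph.mem_edgeSet _).1 hE) hv' ht'

end Summit.CriticalPhenomena.SAWScalingLimit.Theorems.MassRatio.Occupation
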